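import Summits.ValiantsHypothesis.ValiantsHypothesis.Theorems.BarrierLeverPartitionMinorsHitByVPHiddenStatesBallCutCertKit

/-!
# Route BarrierLever — item `PartitionMinorsHitByVP` (stmt-ValiantsHypothesis-19717), line `hidden-states`:
# THE BALL-CUT CERTIFICATE KIT, II — string-coded class lists and the FAST (natural-arithmetic) table

Helper file (`--supports stmt-ValiantsHypothesis-19717`; cell valiant-natproofs, 𝒟-side door (c), registered line
`Cruxes/PartitionMinorsHitByVP/Lines/hidden_states.lean` v10; prover seat val-np-p6 gen 22).  Closes NO item; nothing is certified HERE.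
Companion of `…BallCutCertKit` (p725946 / p729681): (§5) a whole chart level as ONE string literal (`parseClasses`; list literals of
thousands of tuples exhaust the elaborator), (§6) the fast table `certTableN` (each entry a natural product of natural sums reduced once —
the `ZMod p` arithmetic of `certTable` was the interpreter's bottleneck, not the LU) with its kernel bridge `flatMat_certTableN`,
`exists_table_of_packCertN`, and the fast checks `certCheckN` / `certCheckList3N` / ★ `exists_table_of_mem_parseClassesN` (every class coded in
a checked data string is served for every `h`).  Measured: 600 classes of the t = 3 chart at support 8 in ≈ 100 s (one `native_decide`).

HONEST LABEL: toolkit; 19717 stays OPEN; nothing on crux 14610 or VP ≠ VNP.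
-/

set_option linter.dupNamespace false

namespace Summit.ValiantsHypothesis.ValiantsHypothesis.Theorems.BarrierLever.HiddenStates

open Finset

namespace BallCut

open SymbJoin MoorePeel

/-! ## 5. String-coded class lists (appended by val-np-p6 g22): a chart level as ONE string literal

List literals of thousands of tuples exhaust the elaborator (recursion depth / heartbeats); a STRING literal elaborates in one step and
is parsed only under evaluation.  `parseClasses s` reads whitespace-separated naturals six at a time (codes of `A_0, A_1, A_2, C_0, C_1,
C_2`); the theorems of §4 apply verbatim with `l := parseClasses s` (the kernel never evaluates the parser: the served-theorem quantifies
over `e ∈ parseClasses s`, and the Boolean check is the one `native_decide`). -/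

/-- The naturals of a data string: maximal runs of decimal digits, in order (every other character separates). -/
def parseNats (s : String) : List ℕ :=
  let st := s.foldl (fun (st : List ℕ × ℕ × Bool) c =>
      if c.isDigit then (st.1, st.2.1 * 10 + (c.toNat - 48), true)
      else if st.2.2 then (st.2.1 :: st.1, 0, false) else (st.1, 0, false)) ([], 0, false)
  (if st.2.2 then st.2.1 :: st.1 else st.1).reverse

/-- Group a list of naturals six at a time (a trailing incomplete group is dropped). -/
def sextuples : List ℕ → List (ℕ × ℕ × ℕ × ℕ × ℕ × ℕ)
  | a :: b :: c :: d :: e :: f :: rest => (a, b, c, d, e, f) :: sextuples rest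
  | _ => []

/-- **The coded classes of a data string.** -/
def parseClasses (s : String) : List (ℕ × ℕ × ℕ × ℕ × ℕ × ℕ) := sextuples (parseNats s)

/-- ★★ String form of `exists_table_of_mem_certCheckList3`: every class coded in a checked data string is served for every `h`. -/
theorem exists_table_of_mem_parseClasses (n t s : ℕ) {p : ℕ} (hp : p.Prime) (hB : 2 ^ n * (p * p) < packBase)
    (data : String) (hl : certCheckList3 n t s p (parseClasses data) = true)
    (e : ℕ × ℕ × ℕ × ℕ × ℕ × ℕ) (he : e ∈ parseClasses data) {h : ℕ} (σ : Fin n ↪ Fin h)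
    {r : ℕ} (u cols : Fin r → Finset (Fin h)) (hu : Function.Injective u)
    (hU : ∀ i, ((u i).card ≤ t ∧ ∀ j, u i ≠ (codedA n e j).map σ) ∨ ∃ j, u i = (codedC n e j).map σ)
    (hcols : ∀ J : Finset (Fin h), J.card ≤ t → ∃ k, cols k = J) :
    ∃ tx : Option (Fin h) → Fin h → ℂ,
      (Matrix.of fun i k : Fin r => ∏ a ∈ u i, (tx none a + ∑ q ∈ cols k, tx (some q) a)).det ≠ 0 :=
  exists_table_of_mem_certCheckList3 n t s hp hB _ hl e he σ u cols hu hU hcols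

/-! ## 6. The FAST table (natural arithmetic, one reduction per entry) and the fast checks (appended by val-np-p6 g22)

`certTable` evaluates the canonical matrix in `ZMod p` (casts and modular arithmetic per operation — the interpreter's bottleneck, not the
LU).  `certTableN` computes each entry as a natural product of natural sums and reduces once; `flatMat_certTableN` is the kernel bridge,
`exists_table_of_packCertN` / `certCheckN` / `certCheckList3N` / `exists_table_of_mem_parseClassesN` the corresponding API. -/

/-- **The fast certificate table**: entry `(∏_{a ∈ U_i} ∑_{q ∈ J_k} T q a) mod p` computed in `ℕ`. -/
def certTableN (n t : ℕ) {m : ℕ} (A C : Fin m → Finset (Fin n)) (T : Fin n → Fin n → ℕ) (p : ℕ) : Array ℕ :=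
  let R := (ballList n t).length
  let rows := (swapList n t A C).toArray
  let cs := (ballList n t).toArray
  Array.ofFn fun idx : Fin (R * R) => (∏ a ∈ rows.getD (idx.val / R) ∅, ∑ q ∈ cs.getD (idx.val % R) ∅, T q a) % p

/-- KERNEL: the fast table IS the canonical matrix over `ZMod p`. -/
theorem flatMat_certTableN (n t : ℕ) {m : ℕ} (A C : Fin m → Finset (Fin n)) (T : Fin n → Fin n → ℕ) (p : ℕ) :
    flatMat p (certTableN n t A C T p) (ballList n t).length
      = canonMat (ZMod p) (swapList n t A C).toArray (ballList n t).toArray T (ballList n t).length := by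
  ext i k
  have hR : 0 < (ballList n t).length := Fin.pos i
  have hlt : (ballList n t).length * i.val + k.val < (ballList n t).length * (ballList n t).length := by
    have := i.2; have := k.2; nlinarith
  have e1 : ((ballList n t).length * i.val + k.val) / (ballList n t).length = i.val := by
    rw [Nat.mul_add_div hR, Nat.div_eq_of_lt k.2, Nat.add_zero]
  have e2 : ((ballList n t).length * i.val + k.val) % (ballList n t).length = k.val := by
    rw [Nat.mul_add_mod, Nat.mod_eq_of_lt k.2]
  rw [flatMat, certTableN, Array.getD_eq_getD_getElem?, Array.getElem?_ofFn, dif_pos hlt, Option.getD_some, canonMat, Matrix.of_apply]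
  simp only [e1, e2]
  rw [ZMod.natCast_mod]
  push_cast
  rfl

/-- ★ `exists_table_of_packCert` for the fast table. -/
theorem exists_table_of_packCertN (n t : ℕ) {m : ℕ} (A C : Fin m → Finset (Fin n))
    (hA : ∀ l, (A l).card = t) (hC : ∀ l, (C l).card = t + 1)
    (hAi : Function.Injective A) (hCi : Function.Injective C)
    (T : Fin n → Fin n → ℕ) {p : ℕ} (hp : p.Prime) (hB : 2 ^ n * (p * p) < packBase)
    (lu perm pinv : Array ℕ)
    (hchk : packCheckP (certTableN n t A C T p) lu perm (ballList n t).length p = true)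
    (hperm : lupPermCheck perm pinv (ballList n t).length = true)
    {r : ℕ} (u cols : Fin r → Finset (Fin n)) (hu : Function.Injective u)
    (hU : ∀ i, ((u i).card ≤ t ∧ ∀ l, u i ≠ A l) ∨ ∃ l, u i = C l)
    (hcols : ∀ J : Finset (Fin n), J.card ≤ t → ∃ k, cols k = J) :
    ∃ tx : Option (Fin n) → Fin n → ℂ,
      (Matrix.of fun i k : Fin r => ∏ a ∈ u i, (tx none a + ∑ q ∈ cols k, tx (some q) a)).det ≠ 0 := by
  classical
  haveI : Fact p.Prime := ⟨hp⟩
  obtain ⟨hcinj, hUr, hJr⟩ := rigidity t A C hA hC hAi hCi u cols hu hU hcols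
  set LU := swapList n t A C with hLU
  set LB := ballList n t with hLB
  have hgu : Function.Injective LU.get := List.nodup_iff_injective_get.mp (nodup_swapList n t A C)
  have hgc : Function.Injective LB.get := List.nodup_iff_injective_get.mp (nodup_ballList n t)
  have hru : Set.range u = Set.range LU.get := by
    ext U
    rw [Set.mem_range, Set.mem_range, hUr U, ← mem_swapList A C U, List.mem_iff_get]
  have hrc : Set.range cols = Set.range LB.get := by
    ext J
    rw [Set.mem_range, Set.mem_range, hJr J, ← mem_ballList J, List.mem_iff_get]
  set e : Fin r ≃ Fin LU.length :=
    (Equiv.ofInjective u hu).trans ((Equiv.setCongr hru).trans (Equiv.ofInjective _ hgu).symm) with he_def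
  set e' : Fin r ≃ Fin LB.length :=
    (Equiv.ofInjective cols hcinj).trans ((Equiv.setCongr hrc).trans (Equiv.ofInjective _ hgc).symm) with he'_def
  have he : ∀ i, LU.get (e i) = u i := fun i => by
    rw [he_def, Equiv.trans_apply, Equiv.trans_apply, Equiv.apply_ofInjective_symm hgu]
    rfl
  have he' : ∀ k, LB.get (e' k) = cols k := fun k => by
    rw [he'_def, Equiv.trans_apply, Equiv.trans_apply, Equiv.apply_ofInjective_symm hgc]
    rfl
  have hlen : LU.length = LB.length := by
    simpa [Fintype.card_fin] using Fintype.card_congr (e.symm.trans e')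
  set e₁ : Fin r ≃ Fin LB.length := e.trans (finCongr hlen) with he₁_def
  have hrows : ∀ i : Fin r, LU.toArray.getD (e₁ i).val ∅ = u i := fun i => by
    rw [he₁_def, Equiv.trans_apply, finCongr_apply, Fin.val_cast, getD_toArray_eq_get, he]
  have hcs : ∀ k : Fin r, LB.toArray.getD (e' k).val ∅ = cols k := fun k => by
    rw [getD_toArray_eq_get, he']
  have hRB : LB.length * (p * p) < packBase := lt_of_le_of_lt (Nat.mul_le_mul_right _ (length_ballList_le n t)) hB
  have hdetp : (canonMat (ZMod p) LU.toArray LB.toArray T LB.length).det ≠ 0 :=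
    det_ne_zero_of_packCheckP LB.length _ (certTableN n t A C T p) lu perm pinv (flatMat_certTableN n t A C T p) hRB hchk hperm
  have hdetN : (canonMat ℤ LU.toArray LB.toArray T LB.length).det ≠ 0 := by
    intro h0
    apply hdetp
    rw [← canonMat_map, ← RingHom.mapMatrix_apply, ← RingHom.map_det, h0, map_zero]
  have hdetC : ((canonMat ℤ LU.toArray LB.toArray T LB.length).map (Int.castRingHom ℂ)).det ≠ 0 := by
    rw [← RingHom.mapMatrix_apply, ← RingHom.map_det, eq_intCast, Int.cast_ne_zero]
    exact hdetN
  refine ⟨fun o a => Option.elim o 0 fun q => (T q a : ℂ), ?_⟩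
  have hM : (Matrix.of fun i k : Fin r =>
      ∏ a ∈ u i, ((fun (o : Option (Fin n)) (a : Fin n) => Option.elim o (0 : ℂ) fun q => (T q a : ℂ)) none a +
        ∑ q ∈ cols k, (fun (o : Option (Fin n)) (a : Fin n) => Option.elim o (0 : ℂ) fun q => (T q a : ℂ)) (some q) a))
      = ((canonMat ℤ LU.toArray LB.toArray T LB.length).map (Int.castRingHom ℂ)).submatrix e₁ e' := by
    ext i k
    rw [Matrix.submatrix_apply, canonMat_map, canonMat, Matrix.of_apply, Matrix.of_apply, hrows, hcs]
    simp
  rw [hM]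
  exact det_submatrix_ne_zero_of_det_ne_zero _ e₁ e' hdetC

/-- **The fast complete check of ONE class.** -/
def certCheckN (n t : ℕ) {m : ℕ} (A C : Fin m → Finset (Fin n)) (T : Fin n → Fin n → ℕ) (p : ℕ) : Bool :=
  let R := (ballList n t).length
  let tab := certTableN n t A C T p
  let c := packedLUP tab R p
  packCheckP tab c.1 c.2 R p && lupPermCheck c.2 (lupPermInv c.2 R) R

/-- ★ A passed fast check serves the class for every `h`. -/
theorem exists_table_of_certCheckN_map (n t : ℕ) {h : ℕ} (σ : Fin n ↪ Fin h) {m : ℕ} (A C : Fin m → Finset (Fin n))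
    (hA : ∀ l, (A l).card = t) (hC : ∀ l, (C l).card = t + 1)
    (hAi : Function.Injective A) (hCi : Function.Injective C)
    (T : Fin n → Fin n → ℕ) {p : ℕ} (hp : p.Prime) (hB : 2 ^ n * (p * p) < packBase)
    (hc : certCheckN n t A C T p = true)
    {r : ℕ} (u cols : Fin r → Finset (Fin h)) (hu : Function.Injective u)
    (hU : ∀ i, ((u i).card ≤ t ∧ ∀ l, u i ≠ (A l).map σ) ∨ ∃ l, u i = (C l).map σ)
    (hcols : ∀ J : Finset (Fin h), J.card ≤ t → ∃ k, cols k = J) :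
    ∃ tx : Option (Fin h) → Fin h → ℂ,
      (Matrix.of fun i k : Fin r => ∏ a ∈ u i, (tx none a + ∑ q ∈ cols k, tx (some q) a)).det ≠ 0 := by
  simp only [certCheckN, Bool.and_eq_true] at hc
  exact exists_table_multiSwap_map_embedding n t σ A C hA hC hAi hCi
    (fun _ u' cols' hu' hU' hcols' =>
      exists_table_of_packCertN n t A C hA hC hAi hCi T hp hB _ _ _ hc.1 hc.2 u' cols' hu' hU' hcols')
    u cols hu hU hcols

/-- **The fast batch check.** -/
def certCheckList3N (n t s p : ℕ) (l : List (ℕ × ℕ × ℕ × ℕ × ℕ × ℕ)) : Bool :=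
  l.all fun e => shapeOK n t (codedA n e) (codedC n e) && certCheckN n t (codedA n e) (codedC n e) (stdTable s n) p

/-- ★★ Every class coded in a data string that passes the FAST batch check is served for every `h`. -/
theorem exists_table_of_mem_parseClassesN (n t s : ℕ) {p : ℕ} (hp : p.Prime) (hB : 2 ^ n * (p * p) < packBase)
    (data : String) (hl : certCheckList3N n t s p (parseClasses data) = true)
    (e : ℕ × ℕ × ℕ × ℕ × ℕ × ℕ) (he : e ∈ parseClasses data) {h : ℕ} (σ : Fin n ↪ Fin h)
    {r : ℕ} (u cols : Fin r → Finset (Fin h)) (hu : Function.Injective u)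
    (hU : ∀ i, ((u i).card ≤ t ∧ ∀ j, u i ≠ (codedA n e j).map σ) ∨ ∃ j, u i = (codedC n e j).map σ)
    (hcols : ∀ J : Finset (Fin h), J.card ≤ t → ∃ k, cols k = J) :
    ∃ tx : Option (Fin h) → Fin h → ℂ,
      (Matrix.of fun i k : Fin r => ∏ a ∈ u i, (tx none a + ∑ q ∈ cols k, tx (some q) a)).det ≠ 0 := by
  have hall := List.all_eq_true.mp hl e he
  rw [Bool.and_eq_true] at hall
  obtain ⟨hshape, hc⟩ := hall
  rw [shapeOK, decide_eq_true_eq] at hshape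
  obtain ⟨hA, hC, hAi, hCi⟩ := hshape
  exact exists_table_of_certCheckN_map n t σ _ _ hA hC hAi hCi _ hp hB hc u cols hu hU hcols

end BallCut

end Summit.ValiantsHypothesis.ValiantsHypothesis.Theorems.BarrierLever.HiddenStates
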